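import Summits.CriticalPhenomena.PercolationContinuityZ3.Theorems.PercAnnulusCrossingIICPlanarTwoPoint
import HarnessLib

/-!
# Kesten's Theorem (8) on `ℤ²`: `E_ν|C(0) ∩ Λ(n)| ≍ n² π_{1/2}(n)` for the incipient infinite cluster (lane RSW3, p1 gen 7)

builds on p205010 (kernel theorem, internal audit signed; external expert review pending) — not used here.

Seat `prim-rsw3-p1` (gen 7).  The SUMMED form of `PercAnnulusCrossingIICPlanarTwoPoint.lean` (`ν(0 ↔ z) ≍ π_{1/2}(‖z‖_∞)` pointwise), as
suggested by the lead (INBOX 06:34Z): for ANY probability measure `ν` with Kesten's IIC limit property for bond percolation on `ℤ²` at `p_c = 1/2`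
and every `n ≥ 1`,

  `c · n² · π_{1/2}(n) ≤ Σ_{z ∈ Λ(n)} ν(0 ↔ z) ≤ C · n² · π_{1/2}(n)`,

and `Σ_{z ∈ Λ(n)} ν(0 ↔ z) = E_ν|C(0) ∩ Λ(n)|` (linearity; the `ℤ^d` identity `lintegral_card_filter_openConn` of `…IICPlanarDensityMarkov.lean`).
This is Kesten 1986, Theorem (8) with `q = 1` ("`E_ν #(W̃ ∩ S(n)) ≍ n² π_n`"), kernel form, unconditional.  The upper bound needs the ratio
bound `π(k) ≤ A · (n/k) · π(n)` (`1 ≤ k ≤ n`), which is one-arm quasi-multiplicativity (lead gen 9's `oneArmQuasiMultAt_two_criticalProbI`)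
together with the every-aspect annulus window `α(k,n) ≥ (1/4)(k/(4n))` (`Rsw3.le_real_boxCrossing_criticalProbI_of_le` at `d = 2`); then
`Σ_{z ≠ 0} π(‖z‖) ≤ A n π(n) Σ_{k ≤ n} |∂Λ(k)|/k ≤ 20 A n² π(n)`.

* `oneArmProb_le_mul_div_Z2` — `∃ A, ∀ 1 ≤ k ≤ n, π_{1/2}(k) ≤ A · (n/k) · π_{1/2}(n)`;
* `sum_box_oneArmProb_supNorm_le_Z2`, `le_sum_box_oneArmProb_supNorm_Z2` — `Σ_{z ∈ Λ(n)∖0} π(‖z‖) ≍ n² π(n)`;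
* **`iicMeasure_sum_openConn_asymp_Z2`** — `c n² π_{1/2}(n) ≤ Σ_{z ∈ Λ(n)} ν(0 ↔ z) ≤ C n² π_{1/2}(n)` for all `n ≥ 1`.

Helper file for the crux `stmt-CriticalPhenomena-4575` chain; no definitions, no sorries.
References: H. Kesten, PTRF 73 (1986) 369–394, Thm. (8); H. Kesten, Comm. Math. Phys. 109 (1987) (quasi-multiplicativity).
-/

noncomputable section

namespace Summit.CriticalPhenomena.PercolationContinuityZ3.Theorems.Crossing

open MeasureTheory ProbabilityTheory Filter Topology
open Literature.Probability.Percolation Literature.Probability.LatticeModels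
open Literature.Probability.Percolation.DCT16 Literature.Probability.Percolation.DKT20
open Summit.CriticalPhenomena.PercolationContinuityZ3.Theorems.SurfaceTension
open scoped ENNReal ProbabilityTheory Literature.Probability.Percolation

variable {d : ℕ}

/-! ## The one-arm ratio bound on `ℤ²` -/

/-- **`π_{1/2}(k) ≤ A · (n/k) · π_{1/2}(n)` for `1 ≤ k ≤ n`** (one-arm quasi-multiplicativity `c π(k) α(k,n) ≤ π(n)` and the annulus window
`α(k,n) ≥ (1/4)(k/(4n))` at `d = 2`; `A = 16/c`). [cite: Kesten1986, Thm. (8)] -/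
theorem oneArmProb_le_mul_div_Z2 :
    ∃ A : ℝ, 0 < A ∧ ∀ k n : ℕ, 1 ≤ k → k ≤ n →
      oneArmProb 2 (criticalProbI 2) k ≤ A * ((n : ℝ) / k) * oneArmProb 2 (criticalProbI 2) n := by
  obtain ⟨c, hc, hQM⟩ := oneArmQuasiMultAt_two_criticalProbI
  refine ⟨16 / c, by positivity, fun k n hk hkn => ?_⟩
  have hwin := Rsw3.le_real_boxCrossing_criticalProbI_of_le (d := 2) le_rfl hk hkn
  have hqm := hQM k n hk hkn
  have hk0 : (0 : ℝ) < k := by exact_mod_cast hk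
  have hn0 : (0 : ℝ) < n := by exact_mod_cast (lt_of_lt_of_le hk hkn)
  have hπk : 0 ≤ oneArmProb 2 (criticalProbI 2) k := measureReal_nonneg
  -- the window at `d = 2`: `α(k,n) ≥ (1/4)·(k/(4n)) = k/(16 n)`
  have hα : (k : ℝ) / (16 * n) ≤ (bondPercolation (zdGraph 2) (criticalProbI 2)).real (boxCrossing 2 k n) := by
    have h : (2 * ((2 : ℕ) : ℝ))⁻¹ * ((k : ℝ) / (4 * n)) ^ (2 - 1) = (k : ℝ) / (16 * n) := by
      norm_num; ring
    rw [← h]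
    exact hwin
  -- `c π(k) k/(16n) ≤ c π(k) α(k,n) ≤ π(n)`
  have h1 : c * oneArmProb 2 (criticalProbI 2) k * ((k : ℝ) / (16 * n)) ≤ oneArmProb 2 (criticalProbI 2) n :=
    calc c * oneArmProb 2 (criticalProbI 2) k * ((k : ℝ) / (16 * n))
        ≤ c * oneArmProb 2 (criticalProbI 2) k * (bondPercolation (zdGraph 2) (criticalProbI 2)).real (boxCrossing 2 k n) :=
          mul_le_mul_of_nonneg_left hα (mul_nonneg hc.le hπk)
      _ = c * (oneArmProb 2 (criticalProbI 2) k * (bondPercolation (zdGraph 2) (criticalProbI 2)).real (boxCrossing 2 k n)) := by ring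
      _ ≤ oneArmProb 2 (criticalProbI 2) n := hqm
  rw [show 16 / c * ((n : ℝ) / k) * oneArmProb 2 (criticalProbI 2) n = oneArmProb 2 (criticalProbI 2) n * (16 * n) / (c * k) by
    field_simp]
  rw [le_div_iff₀ (mul_pos hc hk0)]
  have h2 := mul_le_mul_of_nonneg_right h1 (by positivity : (0 : ℝ) ≤ 16 * n)
  have h3 : c * oneArmProb 2 (criticalProbI 2) k * ((k : ℝ) / (16 * n)) * (16 * n) = oneArmProb 2 (criticalProbI 2) k * (c * k) := by
    field_simp
  linarith [h2, h3]

/-! ## The lattice sums `Σ_{z ∈ Λ(n) ∖ 0} π(‖z‖)` -/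

/-- `|∂Λ(k)| ≤ 20 k` on `ℤ²` for `k ≥ 1`. [folklore] -/
theorem card_sphere_two_le {k : ℕ} (hk : 1 ≤ k) : ((sphere 2 k).card : ℝ) ≤ 20 * k := by
  obtain ⟨j, rfl⟩ : ∃ j, k = j + 1 := ⟨k - 1, by omega⟩
  have h := card_sphere_succ_le (d := 2) j
  push_cast at h ⊢
  have : (2 * (j : ℝ) + 3) ^ (2 - 1) = 2 * j + 3 := by norm_num
  rw [this] at h
  linarith

open Classical in
/-- **Upper lattice sum: `Σ_{z ∈ Λ(n), z ≠ 0} π_{1/2}(‖z‖_∞) ≤ B · n² · π_{1/2}(n)`** for `n ≥ 1` (fibrewise over the spheres `‖z‖ = k`,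
`1 ≤ k ≤ n`, with `π(k) ≤ A (n/k) π(n)` and `|∂Λ(k)| ≤ 20k`). [cite: Kesten1986, Thm. (8)] -/
theorem sum_box_oneArmProb_supNorm_le_Z2 :
    ∃ B : ℝ, 0 < B ∧ ∀ n : ℕ, 1 ≤ n →
      ∑ z ∈ (box 2 n).filter (fun z => z ≠ 0), oneArmProb 2 (criticalProbI 2) (Site.supNorm z) ≤
        B * (n : ℝ) ^ 2 * oneArmProb 2 (criticalProbI 2) n := by
  obtain ⟨A, hA, hratio⟩ := oneArmProb_le_mul_div_Z2
  refine ⟨20 * A, by positivity, fun n hn => ?_⟩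
  have hn0 : (0 : ℝ) < n := by exact_mod_cast hn
  have hπn : 0 ≤ oneArmProb 2 (criticalProbI 2) n := measureReal_nonneg
  -- each nonzero site of `Λ(n)` with `‖z‖ = k` contributes at most `A (n/k) π(n)`
  have hterm : ∀ z ∈ (box 2 n).filter (fun z => z ≠ 0),
      oneArmProb 2 (criticalProbI 2) (Site.supNorm z) ≤ A * ((n : ℝ) / (Site.supNorm z)) * oneArmProb 2 (criticalProbI 2) n := by
    intro z hz
    rw [Finset.mem_filter] at hz
    have hk1 : 1 ≤ Site.supNorm z := by
      rw [Nat.one_le_iff_ne_zero]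
      exact fun h => hz.2 (Site.supNorm_eq_zero_iff.1 h)
    exact hratio _ n hk1 (mem_box_iff_supNorm_le.1 hz.1)
  -- fibrewise: `Σ_z A (n/‖z‖) π(n) = A π(n) n Σ_{k=1}^{n} |∂Λ(k)|/k ≤ A π(n) n · 20 n`
  have hfib : ∑ z ∈ (box 2 n).filter (fun z => z ≠ 0), A * ((n : ℝ) / (Site.supNorm z)) * oneArmProb 2 (criticalProbI 2) n ≤
      20 * A * (n : ℝ) ^ 2 * oneArmProb 2 (criticalProbI 2) n := by
    have hmaps : ∀ z ∈ (box 2 n).filter (fun z => z ≠ 0), Site.supNorm z ∈ Finset.Icc 1 n := by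
      intro z hz
      rw [Finset.mem_filter] at hz
      rw [Finset.mem_Icc]
      exact ⟨Nat.one_le_iff_ne_zero.2 fun h => hz.2 (Site.supNorm_eq_zero_iff.1 h), mem_box_iff_supNorm_le.1 hz.1⟩
    rw [← Finset.sum_fiberwise_of_maps_to hmaps]
    have hinner : ∀ k ∈ Finset.Icc 1 n,
        ∑ z ∈ ((box 2 n).filter (fun z => z ≠ 0)).filter (fun z => Site.supNorm z = k),
          A * ((n : ℝ) / (Site.supNorm z)) * oneArmProb 2 (criticalProbI 2) n ≤ 20 * A * n * oneArmProb 2 (criticalProbI 2) n := by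
      intro k hk
      rw [Finset.mem_Icc] at hk
      have hk0 : (0 : ℝ) < k := by exact_mod_cast hk.1
      have hsub : ((box 2 n).filter (fun z => z ≠ 0)).filter (fun z => Site.supNorm z = k) ⊆ sphere 2 k := by
        intro z hz
        simp only [Finset.mem_filter] at hz
        rw [mem_sphere]
        exact hz.2
      calc ∑ z ∈ ((box 2 n).filter (fun z => z ≠ 0)).filter (fun z => Site.supNorm z = k),
            A * ((n : ℝ) / (Site.supNorm z)) * oneArmProb 2 (criticalProbI 2) n
          = ∑ z ∈ ((box 2 n).filter (fun z => z ≠ 0)).filter (fun z => Site.supNorm z = k),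
              A * ((n : ℝ) / k) * oneArmProb 2 (criticalProbI 2) n := by
            refine Finset.sum_congr rfl fun z hz => ?_
            simp only [Finset.mem_filter] at hz
            rw [hz.2]
        _ = ((((box 2 n).filter (fun z => z ≠ 0)).filter (fun z => Site.supNorm z = k)).card : ℝ) *
              (A * ((n : ℝ) / k) * oneArmProb 2 (criticalProbI 2) n) := by rw [Finset.sum_const, nsmul_eq_mul]
        _ ≤ ((sphere 2 k).card : ℝ) * (A * ((n : ℝ) / k) * oneArmProb 2 (criticalProbI 2) n) := by
            refine mul_le_mul_of_nonneg_right ?_ (by positivity)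
            exact_mod_cast Finset.card_le_card hsub
        _ ≤ 20 * k * (A * ((n : ℝ) / k) * oneArmProb 2 (criticalProbI 2) n) :=
            mul_le_mul_of_nonneg_right (card_sphere_two_le hk.1) (by positivity)
        _ = 20 * A * n * oneArmProb 2 (criticalProbI 2) n := by field_simp
    calc ∑ k ∈ Finset.Icc 1 n, ∑ z ∈ ((box 2 n).filter (fun z => z ≠ 0)).filter (fun z => Site.supNorm z = k),
          A * ((n : ℝ) / (Site.supNorm z)) * oneArmProb 2 (criticalProbI 2) n
        ≤ ∑ _k ∈ Finset.Icc 1 n, 20 * A * n * oneArmProb 2 (criticalProbI 2) n := Finset.sum_le_sum hinner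
      _ = (n : ℝ) * (20 * A * n * oneArmProb 2 (criticalProbI 2) n) := by
          rw [Finset.sum_const, nsmul_eq_mul, Nat.card_Icc, Nat.add_sub_cancel]
      _ = 20 * A * (n : ℝ) ^ 2 * oneArmProb 2 (criticalProbI 2) n := by ring
  exact (Finset.sum_le_sum hterm).trans hfib

open Classical in
/-- **Lower lattice sum: `4 n² π_{1/2}(n) ≤ Σ_{z ∈ Λ(n), z ≠ 0} π_{1/2}(‖z‖_∞)`** (`π` is antitone and `|Λ(n) ∖ 0| = 4n² + 4n`). [folklore] -/
theorem le_sum_box_oneArmProb_supNorm_Z2 (n : ℕ) :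
    4 * (n : ℝ) ^ 2 * oneArmProb 2 (criticalProbI 2) n ≤
      ∑ z ∈ (box 2 n).filter (fun z => z ≠ 0), oneArmProb 2 (criticalProbI 2) (Site.supNorm z) := by
  have hterm : ∀ z ∈ (box 2 n).filter (fun z => z ≠ 0), oneArmProb 2 (criticalProbI 2) n ≤ oneArmProb 2 (criticalProbI 2) (Site.supNorm z) := by
    intro z hz
    rw [Finset.mem_filter] at hz
    exact real_siteToBoundary_antitone (criticalProbI 2) (mem_box_iff_supNorm_le.1 hz.1)
  have hcard : 4 * (n : ℝ) ^ 2 ≤ (((box 2 n).filter (fun z => z ≠ 0)).card : ℝ) := by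
    have h : ((box 2 n).filter (fun z => z ≠ 0)).card + 1 = (box 2 n).card := by
      have h1 : (box 2 n).filter (fun z => z ≠ 0) = (box 2 n).erase 0 := by
        ext z; simp [Finset.mem_erase, and_comm]
      rw [h1, Finset.card_erase_add_one (zero_mem_box 2 n)]
    rw [card_box] at h
    have h' : ((((box 2 n).filter (fun z => z ≠ 0)).card : ℝ)) + 1 = (2 * n + 1 : ℝ) ^ 2 := by exact_mod_cast h
    nlinarith [h', sq_nonneg (n : ℝ), (Nat.cast_nonneg n : (0 : ℝ) ≤ n)]
  calc 4 * (n : ℝ) ^ 2 * oneArmProb 2 (criticalProbI 2) n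
      ≤ (((box 2 n).filter (fun z => z ≠ 0)).card : ℝ) * oneArmProb 2 (criticalProbI 2) n :=
        mul_le_mul_of_nonneg_right hcard measureReal_nonneg
    _ = ∑ _z ∈ (box 2 n).filter (fun z => z ≠ 0), oneArmProb 2 (criticalProbI 2) n := by rw [Finset.sum_const, nsmul_eq_mul]
    _ ≤ _ := Finset.sum_le_sum hterm

/-! ## Kesten's Theorem (8): the expected volume of the IIC in a box -/

open Classical in
/-- **KESTEN 1986, THEOREM (8) (`q = 1`) FOR BOND PERCOLATION ON `ℤ²`, KERNEL FORM, UNCONDITIONAL**: there are `c, C > 0` such that for every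
probability measure `ν` with Kesten's IIC limit property at `p_c(ℤ²) = 1/2` and every `n ≥ 1`,
`c · n² · π_{1/2}(n) ≤ Σ_{z ∈ Λ(n)} ν(0 ↔ z) ≤ C · n² · π_{1/2}(n)` — the expected number of sites of `Λ(n)` in the incipient infinite cluster
(`Σ_z ν(0 ↔ z) = E_ν|C(0) ∩ Λ(n)|`, `lintegral_card_filter_openConn`) is of order `n² π(n)`. [cite: Kesten1986, Thm. (8)] -/
theorem iicMeasure_sum_openConn_asymp_Z2 :
    ∃ c C : ℝ, 0 < c ∧ 0 < C ∧ ∀ (ν : Measure (BondConfig (Site 2))) [IsProbabilityMeasure ν],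
      (∀ (F : Finset (Sym2 (Site 2))) (E : Set (BondConfig (Site 2))), MeasurableSet E → DeterminedBy E ↑F →
        Tendsto (fun n : ℕ => (bondPercolation (zdGraph 2) (criticalProbI 2)).real (E ∩ siteToBoundary 2 n) /
          oneArmProb 2 (criticalProbI 2) n) atTop (𝓝 (ν.real E))) →
      ∀ n : ℕ, 1 ≤ n →
        c * (n : ℝ) ^ 2 * oneArmProb 2 (criticalProbI 2) n ≤ ∑ z ∈ box 2 n, ν.real (openConn (0 : Site 2) z) ∧
          ∑ z ∈ box 2 n, ν.real (openConn (0 : Site 2) z) ≤ C * (n : ℝ) ^ 2 * oneArmProb 2 (criticalProbI 2) n := by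
  obtain ⟨c, C, hc, hC, hpt⟩ := iicMeasure_real_openConn_asymp_Z2
  obtain ⟨B, hB, hsumU⟩ := sum_box_oneArmProb_supNorm_le_Z2
  obtain ⟨c₁, hc₁, hfloor⟩ := exists_oneArmProb_criticalProbI_lower_half (d := 2) le_rfl
  -- `1 ≤ n² π(n) / c₁ · n^{1/2}`: absorb the origin's contribution `ν(0 ↔ 0) ≤ 1` using the BK floor `π(n) ≥ c₁ n^{-1/2} ≥ c₁/n²`
  refine ⟨4 * c, C * B + 1 / c₁, by positivity, by positivity, fun ν _ hν n hn => ⟨?_, ?_⟩⟩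
  · -- lower bound: drop the origin, use `ν(0↔z) ≥ c π(‖z‖)` and the lower lattice sum
    have hsplit : ∑ z ∈ (box 2 n).filter (fun z => z ≠ 0), ν.real (openConn (0 : Site 2) z) ≤ ∑ z ∈ box 2 n, ν.real (openConn (0 : Site 2) z) :=
      Finset.sum_le_sum_of_subset_of_nonneg (Finset.filter_subset _ _) fun z _ _ => measureReal_nonneg
    refine le_trans ?_ hsplit
    calc 4 * c * (n : ℝ) ^ 2 * oneArmProb 2 (criticalProbI 2) n = c * (4 * (n : ℝ) ^ 2 * oneArmProb 2 (criticalProbI 2) n) := by ring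
      _ ≤ c * ∑ z ∈ (box 2 n).filter (fun z => z ≠ 0), oneArmProb 2 (criticalProbI 2) (Site.supNorm z) :=
          mul_le_mul_of_nonneg_left (le_sum_box_oneArmProb_supNorm_Z2 n) hc.le
      _ = ∑ z ∈ (box 2 n).filter (fun z => z ≠ 0), c * oneArmProb 2 (criticalProbI 2) (Site.supNorm z) := by rw [Finset.mul_sum]
      _ ≤ ∑ z ∈ (box 2 n).filter (fun z => z ≠ 0), ν.real (openConn (0 : Site 2) z) :=
          Finset.sum_le_sum fun z hz => (hpt ν hν z (Finset.mem_filter.1 hz).2).1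
  · -- upper bound: the origin contributes `≤ 1 ≤ n² π(n)/c₁`, the rest `≤ C Σ π(‖z‖) ≤ C B n² π(n)`
    have hn0 : (0 : ℝ) < n := by exact_mod_cast hn
    have hπfloor : c₁ / (n : ℝ) ^ ((((2 : ℕ) : ℝ) - 1) / 2) ≤ oneArmProb 2 (criticalProbI 2) n := hfloor n hn
    have hone : (1 : ℝ) ≤ 1 / c₁ * (n : ℝ) ^ 2 * oneArmProb 2 (criticalProbI 2) n := by
      -- `n^{1/2} ≤ n²` and `c₁ n^{-1/2} ≤ π(n)`
      have hexp : (((2 : ℕ) : ℝ) - 1) / 2 = (1 : ℝ) / 2 := by norm_num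
      rw [hexp] at hπfloor
      have hsqrt : (n : ℝ) ^ ((1 : ℝ) / 2) ≤ (n : ℝ) ^ 2 := by
        have h1 : (1 : ℝ) ≤ n := by exact_mod_cast hn
        calc (n : ℝ) ^ ((1 : ℝ) / 2) ≤ (n : ℝ) ^ (2 : ℝ) := Real.rpow_le_rpow_of_exponent_le h1 (by norm_num)
          _ = (n : ℝ) ^ 2 := by norm_cast
      have hpos : 0 < (n : ℝ) ^ ((1 : ℝ) / 2) := Real.rpow_pos_of_pos hn0 _
      rw [div_le_iff₀ hpos] at hπfloor
      rw [show 1 / c₁ * (n : ℝ) ^ 2 * oneArmProb 2 (criticalProbI 2) n = (oneArmProb 2 (criticalProbI 2) n * (n : ℝ) ^ 2) / c₁ by ring]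
      rw [le_div_iff₀ hc₁, one_mul]
      calc c₁ ≤ oneArmProb 2 (criticalProbI 2) n * (n : ℝ) ^ ((1 : ℝ) / 2) := hπfloor
        _ ≤ oneArmProb 2 (criticalProbI 2) n * (n : ℝ) ^ 2 := mul_le_mul_of_nonneg_left hsqrt measureReal_nonneg
    have hsplit : ∑ z ∈ box 2 n, ν.real (openConn (0 : Site 2) z) =
        ν.real (openConn (0 : Site 2) 0) + ∑ z ∈ (box 2 n).filter (fun z => z ≠ 0), ν.real (openConn (0 : Site 2) z) := by
      have h1 : (box 2 n).filter (fun z => z ≠ 0) = (box 2 n).erase 0 := by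
        ext z; simp [Finset.mem_erase, and_comm]
      rw [h1, ← Finset.add_sum_erase _ _ (zero_mem_box 2 n)]
    rw [hsplit]
    have hrest : ∑ z ∈ (box 2 n).filter (fun z => z ≠ 0), ν.real (openConn (0 : Site 2) z) ≤ C * B * (n : ℝ) ^ 2 * oneArmProb 2 (criticalProbI 2) n :=
      calc ∑ z ∈ (box 2 n).filter (fun z => z ≠ 0), ν.real (openConn (0 : Site 2) z)
          ≤ ∑ z ∈ (box 2 n).filter (fun z => z ≠ 0), C * oneArmProb 2 (criticalProbI 2) (Site.supNorm z) :=
            Finset.sum_le_sum fun z hz => (hpt ν hν z (Finset.mem_filter.1 hz).2).2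
        _ = C * ∑ z ∈ (box 2 n).filter (fun z => z ≠ 0), oneArmProb 2 (criticalProbI 2) (Site.supNorm z) := by rw [Finset.mul_sum]
        _ ≤ C * (B * (n : ℝ) ^ 2 * oneArmProb 2 (criticalProbI 2) n) := mul_le_mul_of_nonneg_left (hsumU n hn) hC.le
        _ = C * B * (n : ℝ) ^ 2 * oneArmProb 2 (criticalProbI 2) n := by ring
    calc ν.real (openConn (0 : Site 2) 0) + ∑ z ∈ (box 2 n).filter (fun z => z ≠ 0), ν.real (openConn (0 : Site 2) z)
        ≤ 1 + C * B * (n : ℝ) ^ 2 * oneArmProb 2 (criticalProbI 2) n := add_le_add measureReal_le_one hrest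
      _ ≤ 1 / c₁ * (n : ℝ) ^ 2 * oneArmProb 2 (criticalProbI 2) n + C * B * (n : ℝ) ^ 2 * oneArmProb 2 (criticalProbI 2) n :=
          add_le_add_left hone _
      _ = (C * B + 1 / c₁) * (n : ℝ) ^ 2 * oneArmProb 2 (criticalProbI 2) n := by ring

end Summit.CriticalPhenomena.PercolationContinuityZ3.Theorems.Crossing

end
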